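import Summits.BirchSwinnertonDyer.Rank1Residual.F1Sign2.BottomLayerAtTwo
import Literature.NumberTheory.EllipticCurves.PadicFiltrationIndexProofs
import Literature.NumberTheory.EllipticCurves.AnticyclotomicPConverseLinks
import Literature.NumberTheory.EllipticCurves.SteinWuthrich2013.SplitLogUniformizationProofs
import Literature.NumberTheory.EllipticCurves.ComplexMultiplicationCoatesWilesReductionIndexProofs
import Literature.NumberTheory.EllipticCurves.TamagawaSubgroupProofs
import Literature.NumberTheory.EllipticCurves.LocalTorsionMultiplicativeProofs
import Literature.NumberTheory.EllipticCurves.LocalTorsionAdditiveReductionPPrimaryProofs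
import HarnessLib

/-!
# Cell `bsd-f1-sign2`, AN-31 (THE BOTTOM LAYER IS A LOCAL BIT AT 2): AN-31a `TwoDivisibilityLogBoundAtTwo` IS A THEOREM —
# `twoDivisibilityLogBoundAtTwo_holds` — hence AN-31a′ `StarCapsExponentAtTwo` (Kriz–Li 2019 Lemma 4.1, exponent currency) and
# AN-31b `LowerHalfOnStarLocusAtTwo` (the `≤` half of the one-door law on the `(★) ∧ c₂ odd` locus) are theorems

PROOF FILE (seat `-ty` g9, «discharge when cheap»; statement file `F1Sign2/BottomLayerAtTwo.lean` = -an g14 Sketch_v22, whose glue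
`starCaps_of_logBound` / `lowerOnStar_of_logBound` reduce a′ and b to a).  THEOREMS ONLY (no `def`, no `sorry`, standard axioms).
The argument is the one printed in Kriz–Li's proof of Lemma 4.1 / Silverman AEC IV.6.4 + VII.2.1–2.2, assembled from TREE theorems:
* `nsPointCountAtTwo_eq_reductionPointCount` — Kriz–Li's casewise `n₂` (`3 − a₂` good / `1` split / `3` non-split / `2` additive) equals the
  tree's `reductionPointCount W 2 = #Ẽ_ns(𝔽₂)` in every reduction type (`frobeniusTrace W 2 = 3 − N₂` by definition;
  `LocalTorsionMult.reductionPointCount_of_mult`; `reductionPointCount_of_additive`).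
* `natCard_point_reduction_baseChange_two` — that count is `Nat.card` of Mathlib's reduction of `W ⊗ ℚ₂` (`reduction_baseChange_eq`,
  `natCard_point_padicModel_residue`, `padicModel_baseChange`; the tree has this only as a `private` lemma, re-proved).
* `tamagawa_mul_nsPointCount_eq_index` — `c₂·n₂ = [E(ℚ₂) : E₁(ℚ₂)]` (`index_formalFiltration`, AEC VII.2.1), so `(c₂n₂)·X ∈ E₁(ℚ₂)` for
  every `X ∈ E(ℚ₂)` (`AddSubgroup.nsmul_index_mem`) — the «junk value of `padicLogPoint` off `Ê(2ℤ₂)`» of the sketch's «why it might fail»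
  sentence never occurs.
* `norm_padicLogPoint_le_half` — `log_Ŵ(E₁(ℚ₂)) ⊆ 2ℤ₂` (`‖log z − z‖ ≤ 2‖z‖²`, `SteinWuthrich2013.norm_padicFormalLog_sub_self_le_two_mul_sq`,
  ultrametric inequality).
* `twoDivisibilityLogBoundAtTwo_holds` — `P = 2^m Q + T`, `T` torsion ⟹ `(c₂n₂)P_j = 2^m·(c₂n₂)Q_j + (c₂n₂)T_j` in `E₁(ℚ₂)`, `log` additive
  and `ℤ`-linear there (`padicLogPoint_add_holds`, `AcPConverseLinks.padicLogPoint_nsmul`) and zero on torsion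
  (`AcPConverseLinks.padicLogPoint_formalIndex_smul_eq_zero_of_isOfFinAddOrder`, `formalIndex W 2 = c₂n₂`), so
  `‖log((c₂n₂)P_j)‖ = 2^{−m}·‖log((c₂n₂)Q_j)‖ ≤ 2^{−(m+1)}`.
PARTITION: none moved (AN-31b is a rung UNDER the L child `stub_doorLowerC` of crux-23715 — the `(★)`-locus, 332/1 576 certified census rows =
Kriz–Li's reach; the layer itself, AN-31 `ExponentCapOfMinimalSelmerAtTwo`, stays OPEN off `(★)`); beyond-print theorem: no (Kriz–Li L.4.1 is
print; this is its kernel form).  BSD is not proved by any of this.  [cite: KrizLi2019, Lemma 4.1] [cite: SilvermanAEC2009, IV.6.4, VII.2.1, VII.2.2]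
-/

set_option autoImplicit false

noncomputable section

open scoped Classical

namespace Summit.BirchSwinnertonDyer.Rank1Residual.F1Sign2.BottomLayer

open Literature.NumberTheory.EllipticCurves Literature.NumberTheory.EllipticCurves.KrizLi2019

/-- `n₂ = #Ẽ_ns(𝔽₂)`: Kriz–Li's casewise count equals the tree's `reductionPointCount W 2` in every reduction type. -/
theorem nsPointCountAtTwo_eq_reductionPointCount (W : WeierstrassCurve ℚ) [W.IsElliptic] [W.IsGloballyMinimal] :
    nsPointCountAtTwo W = W.reductionPointCount 2 := by
  unfold nsPointCountAtTwo
  by_cases hg : W.HasGoodReductionAtPrime 2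
  · rw [if_pos hg]
    have h : (3 : ℤ) - W.frobeniusTrace 2 = (W.reductionPointCount 2 : ℤ) := by
      unfold WeierstrassCurve.frobeniusTrace; push_cast; ring
    rw [h, Int.toNat_natCast]
  · rw [if_neg hg]
    by_cases hm : W.HasMultiplicativeReductionAtPrime 2
    · have h := LocalTorsionMult.reductionPointCount_of_mult W 2 hm
      by_cases hs : W.HasSplitMultiplicativeReductionAtPrime 2
      · rw [if_pos hs]; have := h.1 hs; omega
      · rw [if_neg hs, if_pos hm]; have := h.2 hs; omega
    · have hns : ¬ W.HasSplitMultiplicativeReductionAtPrime 2 := fun hs => hm hs.hasMultiplicativeReductionAtPrime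
      rw [if_neg hns, if_neg hm]
      exact (reductionPointCount_of_additive W 2 hg hm).symm

/-- `#Ẽ_ns(𝔽₂)` read on Mathlib's reduction of `W ⊗ ℚ₂` is the tree's `reductionPointCount W 2`. -/
theorem natCard_point_reduction_baseChange_two (W : WeierstrassCurve ℚ) [W.IsGloballyMinimal]
    [(W.baseChange ℚ_[2]).IsMinimal ℤ_[2]] :
    Nat.card ((W.baseChange ℚ_[2]).reduction ℤ_[2]).toAffine.Point = W.reductionPointCount 2 := by
  have key : ∀ (X : WeierstrassCurve ℚ_[2]) [X.IsMinimal ℤ_[2]],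
      ((WeierstrassCurve.integralModelInt W).map (Int.castRingHom ℤ_[2])).baseChange ℚ_[2] = X →
        Nat.card (X.reduction ℤ_[2]).toAffine.Point = W.reductionPointCount 2 := by
    intro X _ hX
    subst hX
    rw [WeierstrassCurve.reduction_baseChange_eq]
    exact WeierstrassCurve.natCard_point_padicModel_residue W 2
  exact key (W.baseChange ℚ_[2]) (WeierstrassCurve.padicModel_baseChange W 2)

/-- **`c₂ · n₂ = [E(ℚ₂) : E₁(ℚ₂)]`** (AEC VII.2.1 via the tree's `index_formalFiltration`). -/
theorem tamagawa_mul_nsPointCount_eq_index (W : WeierstrassCurve ℚ) [W.IsElliptic] [W.IsGloballyMinimal] :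
    (W.baseChange ℚ_[2]).localTamagawaNumber ℤ_[2] * nsPointCountAtTwo W =
      ((W.baseChange ℚ_[2]).formalFiltration 1).index := by
  haveI : (W.baseChange ℚ_[2]).IsMinimal ℤ_[2] := WeierstrassCurve.isMinimal_map_padic_of_isGloballyMinimal W 2
  rw [WeierstrassCurve.index_formalFiltration (W.baseChange ℚ_[2]) (le_refl 1), pow_zero, mul_one,
    natCard_point_reduction_baseChange_two, nsPointCountAtTwo_eq_reductionPointCount]

/-- **`log_Ŵ(E₁(ℚ₂)) ⊆ 2ℤ₂`**: for `Y ∈ E⁽¹⁾(ℚ₂)` (`‖z(Y)‖ ≤ 1/2`), `‖log_Ŵ z(Y)‖ ≤ 1/2`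
(`‖log z − z‖ ≤ 2‖z‖²`, tree `norm_padicFormalLog_sub_self_le_two_mul_sq`, and the ultrametric inequality). -/
theorem norm_padicLogPoint_le_half (W : WeierstrassCurve ℚ) [W.IsElliptic] [W.IsGloballyMinimal]
    (Y : (W.baseChange ℚ_[2]).toAffine.Point) (hY : Y ∈ (W.baseChange ℚ_[2]).formalFiltration 1) :
    ‖(W.baseChange ℚ_[2]).padicLogPoint Y‖ ≤ 2⁻¹ := by
  obtain ⟨_, hz⟩ := ((W.baseChange ℚ_[2]).mem_formalFiltration_iff).mp hY
  rw [pow_one] at hz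
  have hz' : ‖(W.baseChange ℚ_[2]).formalParameter Y‖ ≤ ((2 : ℕ) : ℝ)⁻¹ := by exact_mod_cast hz
  have h := SteinWuthrich2013.norm_padicFormalLog_sub_self_le_two_mul_sq (W.baseChange ℚ_[2]) hz'
  set z := (W.baseChange ℚ_[2]).formalParameter Y with hzdef
  unfold WeierstrassCurve.padicLogPoint
  rw [← hzdef]
  have hsplit : (W.baseChange ℚ_[2]).padicFormalLog z = ((W.baseChange ℚ_[2]).padicFormalLog z - z) + z := by ring
  rw [hsplit]
  refine (Padic.nonarchimedean _ _).trans (max_le (h.trans ?_) ?_)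
  · have hz2 : ‖z‖ ≤ 2⁻¹ := by exact_mod_cast hz
    have h0 : 0 ≤ ‖z‖ := norm_nonneg z
    nlinarith
  · exact_mod_cast hz

/-- **AN-31a holds**: `P ∈ 2^m E(K) + E(K)_tors ⟹ ‖log_Ŵ((c₂n₂)·P_j)‖ ≤ 2^{-(m+1)}`. -/
theorem twoDivisibilityLogBoundAtTwo_holds : TwoDivisibilityLogBoundAtTwo := by
  intro W _ _ K _ _ j P Q m hPQ
  haveI hmin : (W.baseChange ℚ_[2]).IsMinimal ℤ_[2] := WeierstrassCurve.isMinimal_map_padic_of_isGloballyMinimal W 2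
  set E := W.baseChange ℚ_[2] with hE
  set N : ℕ := E.localTamagawaNumber ℤ_[2] * nsPointCountAtTwo W with hN
  have hNidx : N = (E.formalFiltration 1).index := tamagawa_mul_nsPointCount_eq_index W
  have hNfi : formalIndex W 2 = N := by unfold formalIndex; exact hNidx.symm
  set Pj : E.toAffine.Point := WeierstrassCurve.Affine.Point.map j P with hPj
  set Qj : E.toAffine.Point := WeierstrassCurve.Affine.Point.map j Q with hQj
  set T := P - (2 ^ m) • Q with hTdef
  have hT : IsOfFinAddOrder T := by simpa [AddCommGroup.mem_torsion] using hPQ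
  set Tj : E.toAffine.Point := WeierstrassCurve.Affine.Point.map j T with hTj
  -- the decomposition `N • P_j = 2^m • (N • Q_j) + N • T_j`
  have hPdec : Pj = (2 ^ m) • Qj + Tj := by
    rw [hTj, hTdef, map_sub, map_nsmul, ← hPj, ← hQj]; abel
  have hdec : N • Pj = (2 ^ m) • (N • Qj) + N • Tj := by
    rw [hPdec, nsmul_add, ← mul_nsmul, ← mul_nsmul, mul_comm]
  -- memberships in `E₁(ℚ₂)` and the level-1 bound
  have hQmem : N • Qj ∈ E.formalFiltration 1 := by rw [hNidx]; exact AddSubgroup.nsmul_index_mem _ _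
  have hTmem : N • Tj ∈ E.formalFiltration 1 := by rw [hNidx]; exact AddSubgroup.nsmul_index_mem _ _
  have hQker : E.IsInReductionKernel (N • Qj) := (E.mem_formalFiltration_iff.mp hQmem).1
  have hTker : E.IsInReductionKernel (N • Tj) := (E.mem_formalFiltration_iff.mp hTmem).1
  -- log is additive on `E₁`, ℤ-linear, and kills torsion
  obtain ⟨hker2, hlog2⟩ := AcPConverseLinks.padicLogPoint_nsmul W 2 (N • Qj) hQker (2 ^ m)
  obtain ⟨-, hadd⟩ := WeierstrassCurve.padicLogPoint_add_holds 2 E ((2 ^ m) • (N • Qj)) (N • Tj) hker2 hTker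
  have htors : E.padicLogPoint (N • Tj) = 0 := by
    have h := AcPConverseLinks.padicLogPoint_formalIndex_smul_eq_zero_of_isOfFinAddOrder W 2 (j : K →+* ℚ_[2]) hT
    rw [hNfi] at h
    simpa [padicPointOf, AlgHom.toRingHom_toRatAlgHom, ← hTj] using h
  -- assemble
  have hval : normLogAtTwo W K j P = ((2 ^ m : ℕ) : ℚ_[2]) * E.padicLogPoint (N • Qj) := by
    show E.padicLogPoint (N • Pj) = _
    rw [hdec, hadd, htors, add_zero, hlog2]
  have hQ := norm_padicLogPoint_le_half W (N • Qj) hQmem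
  rw [hval, norm_mul]
  have h2 : ‖((2 ^ m : ℕ) : ℚ_[2])‖ = (2 : ℝ)⁻¹ ^ m := by
    push_cast
    rw [norm_pow]
    congr 1
    exact_mod_cast Padic.norm_p (p := 2)
  rw [h2]
  have htarget : (2 : ℝ) ^ (-((m : ℤ) + 1)) = (2 : ℝ)⁻¹ ^ m * 2⁻¹ := by
    rw [show (-((m : ℤ) + 1)) = -(((m + 1 : ℕ) : ℤ)) by push_cast; ring, zpow_neg, zpow_natCast, pow_succ, mul_inv, inv_pow]
  rw [htarget]
  exact mul_le_mul_of_nonneg_left hQ (pow_nonneg (by norm_num) m)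

/-- **AN-31a′ holds (Kriz–Li 2019 Lemma 4.1 in exponent currency is a theorem of the tree)**: by the statement file's glue
`starCaps_of_logBound` from `twoDivisibilityLogBoundAtTwo_holds`. [cite: KrizLi2019, Lemma 4.1] -/
theorem starCapsExponentAtTwo_holds : StarCapsExponentAtTwo :=
  starCaps_of_logBound twoDivisibilityLogBoundAtTwo_holds

/-- **AN-31b holds: the `≤` half of the one-door law (`DoorIndexLawLowerCAtTwo` with the extra binders `j`, `Odd c₂`, `(★)`) IS A
THEOREM on the `(★) ∧ c₂ odd` locus** — the first rung of `stub_doorLowerC` (crux-23715, L child), by the statement file's glue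
`lowerOnStar_of_logBound`. [cite: KrizLi2019, Lemma 4.1] -/
theorem lowerHalfOnStarLocusAtTwo_holds : LowerHalfOnStarLocusAtTwo :=
  lowerOnStar_of_logBound twoDivisibilityLogBoundAtTwo_holds

end Summit.BirchSwinnertonDyer.Rank1Residual.F1Sign2.BottomLayer

end
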